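import Literature.NumberTheory.EllipticCurves.ModThreeReducibleIffPsi3Root
import HarnessLib

/-!
# Transport of the stable-line SIGN along an equivariant isomorphism of `3`-torsion modules
(route `CyclotomicUntwist`, K1 supply — O6 lane V10, step (M1) of the P-SHAPE-PARTNER law
`Additive.CompanionShapeLawThree`; cell `bsd-wall`, seat `bsd-line-cycu-p2` g5; THEOREMS ONLY)

`V, V'` elliptic curves over a field `K` of characteristic `0`, `f : V[3] ≃+ V'[3]` an additive
isomorphism of the geometric `3`-torsion (`WeierstrassCurve.geomTorsion`, points over `K̄`)
commuting with `Γ_K`.  A `K`-root `x₀` of `Ψ₃(V)` is the abscissa of a `Γ_K`-stable line `{O, ±P}`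
of `V[3]` (Cremona 1997 §3.8; tree `ModThreeReducibleIffPsi3Root.lean`), and `Γ_K` acts on it by
the quadratic character of `K(√F(x₀))/K`, `F(x₀) := Ψ₂²(x₀) = (2y(P) + a₁x₀ + a₃)²` (Serre 1972
§1.11: `σP = P` iff `σ` fixes `y(P)` iff `σ` fixes `2y(P) + a₁x₀ + a₃`).  PROVED:
* `exists_isRoot_Ψ₃_sq_mul_of_equivariant` — along `f` a `K`-root `x₀` of `Ψ₃(V)` goes to a
  `K`-root `x₀'` of `Ψ₃(V')` with `Ψ₂²(V')(x₀') = c²·Ψ₂²(V)(x₀)`, `c ∈ Kˣ` (same character; the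
  image abscissa descends by `InfiniteGalois.mem_range_algebraMap_iff_fixed`; Kummer: two square
  roots cut out the same character of `Γ_K` iff the radicands differ by a square);
* `isRoot_Ψ₃_unique_of_equivariant` — if `Ψ₃(V')` has at most one `K`-root, so has `Ψ₃(V)`.
Used at `K = ℚ₃` by the sequel: the V10 shapes of `Additive/WildThreeResidualShape.lean` read the
square class of `F(x₀)`, so the shape of `W[3]|G_{ℚ₃}` is that of any `G` with `G[3] ≅ W[3]`.
HONEST FRAMING: helper theorems; nothing about any particular curve is asserted; K1/K2 of the route
are neither proved nor reduced; BSD is not proved for any curve. References: [Serre1972] §1.11;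
[Cremona1997] §3.8; [SilvermanAEC2009] III.2.3, Ex. 3.7, VIII.§1.
-/

set_option linter.dupNamespace false

noncomputable section

open scoped Classical

universe u

namespace Summit.BirchSwinnertonDyer.BirchSwinnertonDyer.Theorems.CompanionShape

open Polynomial Field WeierstrassCurve Literature.NumberTheory.EllipticCurves

variable {K : Type u} [Field K] [CharZero K]

/-- Galois descent in `K̄/K` (`K` of characteristic `0`): a `Γ_K`-fixed element of `K̄` lies in `K`.
[folklore] -/
private theorem exists_algebraMap_eq_of_forall_smul_eq {x : AlgebraicClosure K}
    (hx : ∀ σ : absoluteGaloisGroup K, σ • x = x) :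
    ∃ c : K, algebraMap K (AlgebraicClosure K) c = x := by
  haveI : IsGalois K (AlgebraicClosure K) := {}
  exact (InfiniteGalois.mem_range_algebraMap_iff_fixed x).mpr fun σ ↦ hx σ

omit [CharZero K] in
/-- `Γ_K` fixes `K`. [folklore] -/
private theorem smul_algebraMap (σ : absoluteGaloisGroup K) (c : K) :
    σ • algebraMap K (AlgebraicClosure K) c = algebraMap K (AlgebraicClosure K) c := by
  let τ : AlgebraicClosure K ≃ₐ[K] AlgebraicClosure K := σ
  show τ _ = _
  exact τ.commutes c

section RationalAbscissa

variable (V : WeierstrassCurve K) [V.IsElliptic]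

omit [CharZero K] [V.IsElliptic] in
/-- `σ ∈ Γ_K` acts on a point `T = (x, y) ∈ V[3]` with `σx = x` by `σT = ±T` (the two points
with abscissa `x`). [cite: SilvermanAEC2009, III.2.3 (negation) and VIII.§1] -/
theorem smul_eq_self_or_eq_neg {T : geomTorsion V (3 : ℤ)} {x y : AlgebraicClosure K}
    {h : (V.baseChange (AlgebraicClosure K)).toAffine.Nonsingular x y}
    (hT : (T : geomPoints V) = Affine.Point.some x y h)
    (σ : absoluteGaloisGroup K) (hx : σ • x = x) : σ • T = T ∨ σ • T = -T := by
  let τ : AlgebraicClosure K ≃ₐ[K] AlgebraicClosure K := σ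
  have hτx : τ x = x := hx
  have hval : ((σ • T : geomTorsion V (3 : ℤ)) : geomPoints V) =
      Affine.Point.map (τ : AlgebraicClosure K →ₐ[K] AlgebraicClosure K)
        (Affine.Point.some x y h) := by
    rw [Literature.NumberTheory.EllipticCurves.AddSubgroup.torsionBy.coe_smul, hT]
    rfl
  rw [Affine.Point.map_some] at hval
  obtain ⟨h₁', hval'⟩ : ∃ h₁', ((σ • T : geomTorsion V (3 : ℤ)) : geomPoints V) =
      Affine.Point.some (W' := (V.baseChange (AlgebraicClosure K)).toAffine) (τ x) (τ y) h₁' :=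
    ⟨_, hval⟩
  rcases (Affine.Point.X_eq_iff (h₁ := h₁') (h₂ := h)).mp hτx with h' | h'
  · left
    apply Subtype.ext
    rw [hval', hT]
    exact h'
  · right
    apply Subtype.ext
    rw [hval', AddSubgroup.coe_neg, hT]
    exact h'

omit [CharZero K] [V.IsElliptic] in
/-- … and `σT = T` iff `σ` fixes the ordinate `y`. [cite: SilvermanAEC2009, VIII.§1] -/
theorem smul_eq_self_iff {T : geomTorsion V (3 : ℤ)} {x y : AlgebraicClosure K}
    {h : (V.baseChange (AlgebraicClosure K)).toAffine.Nonsingular x y}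
    (hT : (T : geomPoints V) = Affine.Point.some x y h)
    (σ : absoluteGaloisGroup K) (hx : σ • x = x) : σ • T = T ↔ σ • y = y := by
  let τ : AlgebraicClosure K ≃ₐ[K] AlgebraicClosure K := σ
  have hτx : τ x = x := hx
  have hval : ((σ • T : geomTorsion V (3 : ℤ)) : geomPoints V) =
      Affine.Point.map (τ : AlgebraicClosure K →ₐ[K] AlgebraicClosure K)
        (Affine.Point.some x y h) := by
    rw [Literature.NumberTheory.EllipticCurves.AddSubgroup.torsionBy.coe_smul, hT]
    rfl
  rw [Affine.Point.map_some] at hval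
  obtain ⟨h₁', hval'⟩ : ∃ h₁', ((σ • T : geomTorsion V (3 : ℤ)) : geomPoints V) =
      Affine.Point.some (W' := (V.baseChange (AlgebraicClosure K)).toAffine) (τ x) (τ y) h₁' :=
    ⟨_, hval⟩
  show σ • T = T ↔ τ y = y
  constructor
  · intro he
    rw [he, hT] at hval'
    exact (Affine.Point.some.inj hval').2.symm
  · intro hy
    apply Subtype.ext
    rw [hval', hT]
    show Affine.Point.some (τ x) (τ y) h₁' = Affine.Point.some x y h
    simp only [Affine.Point.some.injEq]
    exact ⟨hτx, hy⟩

omit [V.IsElliptic] in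
/-- **The sign of the line.** For a point `P = (x, y)` over `K̄` with `x = x₀ ∈ K`: the element
`w = 2y + a₁x₀ + a₃ ∈ K̄` has `w² = F(x₀) := Ψ₂²(x₀)` (Silverman Ex. 3.7(a): `ψ₂² = Ψ₂²(x)` on the
curve), and `σ` fixes `y` iff `σ` fixes `w` (characteristic `0`). [cite: SilvermanAEC2009, Exercise 3.7(a)] -/
theorem exists_sq_eq_algebraMap_eval_Ψ₂Sq {x₀ : K} {x y : AlgebraicClosure K}
    (h : (V.baseChange (AlgebraicClosure K)).toAffine.Nonsingular x y)
    (hx : x = algebraMap K (AlgebraicClosure K) x₀) :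
    ∃ w : AlgebraicClosure K, w ^ 2 = algebraMap K (AlgebraicClosure K) (V.Ψ₂Sq.eval x₀) ∧
      ∀ σ : absoluteGaloisGroup K, (σ • y = y ↔ σ • w = w) := by
  set V' := V.baseChange (AlgebraicClosure K) with hV'
  refine ⟨(V'.ψ 2).evalEval x y, ?_, fun σ ↦ ?_⟩
  · have hsq := V'.evalEval_ψ_sq h.left 2
    rw [hsq, ΨSq_two, hV', WeierstrassCurve.baseChange, map_Ψ₂Sq, eval_map, hx, eval₂_at_apply]
  · let τ : AlgebraicClosure K ≃ₐ[K] AlgebraicClosure K := σ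
    have hτx : τ x = x := by rw [hx]; exact τ.commutes x₀
    have ha₁ : τ V'.a₁ = V'.a₁ := by rw [hV']; exact τ.commutes V.a₁
    have ha₃ : τ V'.a₃ = V'.a₃ := by rw [hV']; exact τ.commutes V.a₃
    have hw : (V'.ψ 2).evalEval x y = 2 * y + V'.a₁ * x + V'.a₃ := by
      rw [ψ_two, ψ₂, Affine.evalEval_polynomialY]
    have hτw : τ ((V'.ψ 2).evalEval x y) = 2 * τ y + V'.a₁ * x + V'.a₃ := by
      rw [hw, map_add, map_add, map_mul, map_mul, map_ofNat, hτx, ha₁, ha₃]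
    show τ y = y ↔ τ _ = _
    rw [hτw, hw]
    constructor
    · intro hy
      rw [hy]
    · intro hyw
      have h2 : (2 : AlgebraicClosure K) ≠ 0 := two_ne_zero
      have : 2 * τ y = 2 * y := by linear_combination hyw
      exact mul_left_cancel₀ h2 this

omit [CharZero K] in
/-- **A `K`-root of `Ψ₃` carries a point of `E[3]`**: over `K̄` there is `y` with
`P = (x₀, y) ∈ V[3]` (the Weierstrass equation is solvable in `y`; a root of `Ψ₃` is not a root of
`Ψ₂²` on an elliptic curve, so `P` is not `2`-torsion and `3P = O`, Silverman Ex. 3.7).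
[cite: Cremona1997, §3.8 (l = 3)] [cite: SilvermanAEC2009, Exercise 3.7] -/
theorem exists_some_mem_geomTorsion_of_isRoot_Ψ₃ {x₀ : K} (hx₀ : V.Ψ₃.IsRoot x₀) :
    ∃ (y : AlgebraicClosure K)
      (h : (V.baseChange (AlgebraicClosure K)).toAffine.Nonsingular
        (algebraMap K (AlgebraicClosure K) x₀) y),
      (Affine.Point.some _ y h : geomPoints V) ∈ geomTorsion V (3 : ℤ) := by
  set V' := V.baseChange (AlgebraicClosure K) with hV'
  set x : AlgebraicClosure K := algebraMap K (AlgebraicClosure K) x₀ with hxdef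
  have hΨ : V'.Ψ₃.eval x = 0 := by
    rw [hV', WeierstrassCurve.baseChange, map_Ψ₃, eval_map, hxdef, eval₂_at_apply, hx₀.eq_zero,
      map_zero]
  obtain ⟨y, hxy⟩ := V'.exists_equation x
  have hns : V'.toAffine.Nonsingular x y := (Affine.equation_iff_nonsingular (W := V'.toAffine)).mp hxy
  have hΔ : V'.Δ ≠ 0 := V'.coe_Δ' ▸ V'.Δ'.ne_zero
  have hy : y ≠ V'.toAffine.negY x y := by
    intro hneg
    apply V'.eval_Ψ₂Sq_ne_zero_of_eval_Ψ₃_eq_zero hΔ hΨ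
    have hsq := V'.evalEval_ψ_sq hxy 2
    rw [ΨSq_two, ψ_two, ψ₂, Affine.evalEval_polynomialY] at hsq
    have h0 : 2 * y + V'.a₁ * x + V'.a₃ = 0 := by
      rw [Affine.negY] at hneg
      linear_combination hneg
    rw [← hsq]
    have : (2 * y + V'.toAffine.a₁ * x + V'.toAffine.a₃) = 0 := h0
    rw [this]
    ring
  refine ⟨y, hns, ?_⟩
  have h3 : (3 : ℤ) • (Affine.Point.some x y hns : V'.toAffine.Point) = 0 := by
    refine (three_smul_some_eq_zero_iff hns hy).mpr ?_
    rw [ψ_three, evalEval_C]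
    exact hΨ
  exact (Literature.NumberTheory.EllipticCurves.mem_torsionBy_iff).mpr h3

omit [V.IsElliptic] in
/-- **A stable line has a `K`-rational abscissa which is a root of `Ψ₃`**: if `T = (x, y) ∈ V[3]`
spans a `Γ_K`-stable line (`σT = ±T` for all `σ`), then `x ∈ K` and `Ψ₃(x) = 0`.
[cite: Cremona1997, §3.8 (l = 3: "just one x-coordinate, which must be rational")]
[cite: SilvermanAEC2009, III.4.12, Remark III.4.13.2 and Exercise 3.7] -/
theorem exists_isRoot_of_line {T : geomTorsion V (3 : ℤ)} {x y : AlgebraicClosure K}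
    {h : (V.baseChange (AlgebraicClosure K)).toAffine.Nonsingular x y}
    (hT : (T : geomPoints V) = Affine.Point.some x y h)
    (hpm : ∀ σ : absoluteGaloisGroup K, σ • T = T ∨ σ • T = -T) :
    ∃ x₀ : K, algebraMap K (AlgebraicClosure K) x₀ = x ∧ V.Ψ₃.IsRoot x₀ := by
  -- `σ x = x` for every `σ`
  have hx : ∀ σ : absoluteGaloisGroup K, σ • x = x := by
    intro σ
    let τ : AlgebraicClosure K ≃ₐ[K] AlgebraicClosure K := σ
    show τ x = x
    rcases hpm σ with hσ | hσ
    · have hσ' := congrArg Subtype.val hσ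
      rw [Literature.NumberTheory.EllipticCurves.AddSubgroup.torsionBy.coe_smul, hT] at hσ'
      change Affine.Point.map (τ : AlgebraicClosure K →ₐ[K] AlgebraicClosure K)
        (Affine.Point.some x y h) = Affine.Point.some x y h at hσ'
      rw [Affine.Point.map_some] at hσ'
      simpa only [Affine.Point.some.injEq, AlgEquiv.coe_toAlgHom] using
        (Affine.Point.some.inj hσ').1
    · have hσ' := congrArg Subtype.val hσ
      rw [Literature.NumberTheory.EllipticCurves.AddSubgroup.torsionBy.coe_smul,
        AddSubgroup.coe_neg, hT] at hσ'
      change Affine.Point.map (τ : AlgebraicClosure K →ₐ[K] AlgebraicClosure K)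
        (Affine.Point.some x y h) = -Affine.Point.some x y h at hσ'
      rw [Affine.Point.map_some, Affine.Point.neg_some] at hσ'
      simpa only [Affine.Point.some.injEq, AlgEquiv.coe_toAlgHom] using
        (Affine.Point.some.inj hσ').1
  obtain ⟨x₀, hx₀⟩ := exists_algebraMap_eq_of_forall_smul_eq hx
  -- `Ψ₃(x) = 0` over `K̄` descends to `Ψ₃(x₀) = 0` over `K`
  have hΨ : (V.baseChange (AlgebraicClosure K)).Ψ₃.eval x = 0 :=
    V.eval_divisionPolynomial_three_eq_zero_of_eq_some (T := T) hT
  rw [← hx₀, WeierstrassCurve.baseChange, map_Ψ₃, eval_map] at hΨ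
  have hΨ' : algebraMap K (AlgebraicClosure K) (V.Ψ₃.eval x₀) = 0 := by
    rwa [← eval₂_at_apply]
  exact ⟨x₀, hx₀, (map_eq_zero_iff _ (algebraMap K (AlgebraicClosure K)).injective).mp hΨ'⟩

omit [CharZero K] [V.IsElliptic] in
/-- A non-zero element of `V[3]` is an affine point `(x, y)`. [folklore] -/
theorem exists_eq_some_of_ne_zero {T : geomTorsion V (3 : ℤ)} (hT : T ≠ 0) :
    ∃ (x y : AlgebraicClosure K) (h : (V.baseChange (AlgebraicClosure K)).toAffine.Nonsingular x y),
      (T : geomPoints V) = Affine.Point.some x y h := by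
  obtain ⟨Q, hQmem⟩ := T
  have hQ0 : Q ≠ 0 := fun hQ ↦ hT (Subtype.ext hQ)
  change (V.baseChange (AlgebraicClosure K)).toAffine.Point at Q
  rcases Q with _ | ⟨x, y, hxy⟩
  · exact (hQ0 rfl).elim
  · exact ⟨_, _, hxy, rfl⟩

end RationalAbscissa

/-- **Kummer for quadratic characters.** `a, b ∈ Kˣ` with square roots `α, β ∈ K̄`; if every
`σ ∈ Γ_K` fixes `α` iff it fixes `β`, then `b = c²·a` with `c ∈ Kˣ` (`αβ` is `Γ_K`-fixed, hence in
`K`, and `(αβ)² = ab`). [folklore] -/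
theorem exists_eq_sq_mul_of_forall_smul_iff {a b : K} (ha : a ≠ 0) (hb : b ≠ 0)
    {α β : AlgebraicClosure K} (hα : α ^ 2 = algebraMap K (AlgebraicClosure K) a)
    (hβ : β ^ 2 = algebraMap K (AlgebraicClosure K) b)
    (h : ∀ σ : absoluteGaloisGroup K, (σ • α = α ↔ σ • β = β)) :
    ∃ c : K, c ≠ 0 ∧ b = c ^ 2 * a := by
  set ι := algebraMap K (AlgebraicClosure K) with hι
  have hα0 : α ≠ 0 := by
    intro h0
    rw [h0, zero_pow two_ne_zero, eq_comm, map_eq_zero_iff _ ι.injective] at hα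
    exact ha hα
  have pm : ∀ (σ : absoluteGaloisGroup K) {γ : AlgebraicClosure K} {c : K}, γ ^ 2 = ι c →
      σ • γ = γ ∨ σ • γ = -γ := by
    intro σ γ c hγ
    have hsq : (σ • γ) ^ 2 = γ ^ 2 := by
      rw [← smul_pow', hγ, hι, smul_algebraMap]
    exact sq_eq_sq_iff_eq_or_eq_neg.mp hsq
  -- `αβ` is fixed, hence in `K`, and `(αβ)² = ab`
  have hfix : ∀ σ : absoluteGaloisGroup K, σ • (α * β) = α * β := by
    intro σ
    rw [smul_mul']
    rcases pm σ hα with h1 | h1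
    · rw [h1, (h σ).mp h1]
    · have hβ' : σ • β = -β := (pm σ hβ).resolve_left fun h2 ↦ hα0 <| by
        have h3 : -α = α := h1.symm.trans ((h σ).mpr h2)
        have : (2 : AlgebraicClosure K) * α = 0 := by linear_combination -h3
        exact (mul_eq_zero.mp this).resolve_left two_ne_zero
      rw [h1, hβ']
      ring
  obtain ⟨c, hc⟩ := exists_algebraMap_eq_of_forall_smul_eq hfix
  have hc2 : c ^ 2 = a * b := by
    apply ι.injective
    rw [map_pow, hc, mul_pow, hα, hβ, map_mul]
  have hb' : b = (c / a) ^ 2 * a := by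
    field_simp
    linear_combination -hc2
  refine ⟨c / a, fun h0 ↦ hb ?_, hb'⟩
  rw [hb', h0]
  ring

section Transport

variable (V V' : WeierstrassCurve K) [V.IsElliptic] [V'.IsElliptic]
  (f : geomTorsion V (3 : ℤ) ≃+ geomTorsion V' (3 : ℤ))
  (hf : ∀ (σ : absoluteGaloisGroup K) (P : geomTorsion V (3 : ℤ)), f (σ • P) = σ • f P)

omit [CharZero K] [V.IsElliptic] [V'.IsElliptic] in
include hf in
/-- A line goes to a line with the same character: `σ(fT) = ±fT`, and `σT = T ↔ σ(fT) = fT`.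
[folklore] -/
theorem line_map {T : geomTorsion V (3 : ℤ)}
    (hpm : ∀ σ : absoluteGaloisGroup K, σ • T = T ∨ σ • T = -T) :
    (∀ σ : absoluteGaloisGroup K, σ • f T = f T ∨ σ • f T = -f T) ∧
      ∀ σ : absoluteGaloisGroup K, (σ • T = T ↔ σ • f T = f T) := by
  refine ⟨fun σ ↦ ?_, fun σ ↦ ?_⟩
  · rw [← hf]
    rcases hpm σ with h1 | h1
    · exact Or.inl (by rw [h1])
    · exact Or.inr (by rw [h1, map_neg])
  · rw [← hf]
    exact f.injective.eq_iff.symm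

include hf in
/-- **Transport of a root with its sign (M1).** Along a `Γ_K`-equivariant `f : V[3] ≃+ V'[3]`,
a `K`-root `x₀` of `Ψ₃(V)` yields a `K`-root `x₀'` of `Ψ₃(V')` with
`Ψ₂²(V')(x₀') = c²·Ψ₂²(V)(x₀)`, `c ∈ Kˣ`: the stable line above `x₀` and its image carry the same
quadratic character of `Γ_K`, read through `√Ψ₂²(x₀)` resp. `√Ψ₂²(x₀')`.
[cite: Serre1972, §1.11] [cite: Cremona1997, §3.8 (l = 3)] -/
theorem exists_isRoot_Ψ₃_sq_mul_of_equivariant {x₀ : K} (hx₀ : V.Ψ₃.IsRoot x₀) :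
    ∃ x₀' : K, V'.Ψ₃.IsRoot x₀' ∧ ∃ c : K, c ≠ 0 ∧ V'.Ψ₂Sq.eval x₀' = c ^ 2 * V.Ψ₂Sq.eval x₀ := by
  obtain ⟨y, h, hmem⟩ := exists_some_mem_geomTorsion_of_isRoot_Ψ₃ V hx₀
  set T : geomTorsion V (3 : ℤ) := ⟨_, hmem⟩ with hTdef
  have hT : (T : geomPoints V) = Affine.Point.some _ y h := rfl
  have hpm : ∀ σ : absoluteGaloisGroup K, σ • T = T ∨ σ • T = -T := fun σ ↦
    smul_eq_self_or_eq_neg V hT σ (smul_algebraMap σ x₀)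
  -- its image `f T = (x', y')`, a line with `x' = x₀' ∈ K` a root of `Ψ₃(V')`
  have hT0 : T ≠ 0 := fun h0 ↦ Affine.Point.some_ne_zero h (congrArg Subtype.val h0)
  have hT'0 : f T ≠ 0 := fun h0 ↦ hT0 (f.injective (by rw [h0, map_zero]))
  obtain ⟨hpm', hiff⟩ := line_map V V' f hf hpm
  obtain ⟨x', y', h', hT'⟩ := exists_eq_some_of_ne_zero V' hT'0
  obtain ⟨x₀', hx₀', hroot'⟩ := exists_isRoot_of_line V' hT' hpm'
  have hxfix' : ∀ σ : absoluteGaloisGroup K, σ • x' = x' := fun σ ↦ by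
    rw [← hx₀']; exact smul_algebraMap σ x₀'
  -- the two signs, cutting out the same character of `Γ_K`
  obtain ⟨w, hw, hyw⟩ := exists_sq_eq_algebraMap_eval_Ψ₂Sq V h rfl
  obtain ⟨w', hw', hyw'⟩ := exists_sq_eq_algebraMap_eval_Ψ₂Sq V' h' hx₀'.symm
  have key : ∀ σ : absoluteGaloisGroup K, (σ • w = w ↔ σ • w' = w') := by
    intro σ
    rw [← hyw σ, ← hyw' σ, ← smul_eq_self_iff V hT σ (smul_algebraMap σ x₀), hiff σ,
      smul_eq_self_iff V' hT' σ (hxfix' σ)]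
  have ha : V.Ψ₂Sq.eval x₀ ≠ 0 :=
    V.eval_Ψ₂Sq_ne_zero_of_eval_Ψ₃_eq_zero (V.coe_Δ' ▸ V.Δ'.ne_zero) hx₀.eq_zero
  have hb : V'.Ψ₂Sq.eval x₀' ≠ 0 :=
    V'.eval_Ψ₂Sq_ne_zero_of_eval_Ψ₃_eq_zero (V'.coe_Δ' ▸ V'.Δ'.ne_zero) hroot'.eq_zero
  obtain ⟨c, hc0, hc⟩ := exists_eq_sq_mul_of_forall_smul_iff ha hb hw hw' key
  exact ⟨x₀', hroot', c, hc0, hc⟩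

omit [V'.IsElliptic] in
include hf in
/-- **Uniqueness transports (M1′).** If `Ψ₃(V')` has at most one `K`-root then so has `Ψ₃(V)`:
two `K`-roots of `Ψ₃(V)` give stable lines whose images under `f` have `K`-rational abscissas,
both equal to the root of `Ψ₃(V')`, so the images — hence the lines — are `±` each other.
[cite: Cremona1997, §3.8 (l = 3)] [cite: SilvermanAEC2009, III.2.3] -/
theorem isRoot_Ψ₃_unique_of_equivariant {x₁' : K} (huniq' : ∀ r : K, V'.Ψ₃.IsRoot r → r = x₁')
    {r s : K} (hr : V.Ψ₃.IsRoot r) (hs : V.Ψ₃.IsRoot s) : r = s := by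
  set ι := algebraMap K (AlgebraicClosure K) with hι
  obtain ⟨yr, hr', hmemr⟩ := exists_some_mem_geomTorsion_of_isRoot_Ψ₃ V hr
  obtain ⟨ys, hs', hmems⟩ := exists_some_mem_geomTorsion_of_isRoot_Ψ₃ V hs
  set Tr : geomTorsion V (3 : ℤ) := ⟨_, hmemr⟩ with hTrdef
  set Ts : geomTorsion V (3 : ℤ) := ⟨_, hmems⟩ with hTsdef
  have hTr : (Tr : geomPoints V) = Affine.Point.some _ yr hr' := rfl
  have hTs : (Ts : geomPoints V) = Affine.Point.some _ ys hs' := rfl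
  have hTr0 : Tr ≠ 0 := fun h0 ↦ Affine.Point.some_ne_zero hr' (congrArg Subtype.val h0)
  have hTs0 : Ts ≠ 0 := fun h0 ↦ Affine.Point.some_ne_zero hs' (congrArg Subtype.val h0)
  have hfTr0 : f Tr ≠ 0 := fun h0 ↦ hTr0 (f.injective (by rw [h0, map_zero]))
  have hfTs0 : f Ts ≠ 0 := fun h0 ↦ hTs0 (f.injective (by rw [h0, map_zero]))
  obtain ⟨hpmr', -⟩ := line_map V V' f hf (fun σ ↦ smul_eq_self_or_eq_neg V hTr σ (smul_algebraMap σ r))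
  obtain ⟨hpms', -⟩ := line_map V V' f hf (fun σ ↦ smul_eq_self_or_eq_neg V hTs σ (smul_algebraMap σ s))
  obtain ⟨xr, yr', hr'', hfTr⟩ := exists_eq_some_of_ne_zero V' hfTr0
  obtain ⟨xs, ys', hs'', hfTs⟩ := exists_eq_some_of_ne_zero V' hfTs0
  obtain ⟨r₀, hr₀, hrootr⟩ := exists_isRoot_of_line V' hfTr hpmr'
  obtain ⟨s₀, hs₀, hroots⟩ := exists_isRoot_of_line V' hfTs hpms'
  have hx : xr = xs := by rw [← hr₀, ← hs₀, huniq' r₀ hrootr, huniq' s₀ hroots]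
  have key : Ts = Tr ∨ Ts = -Tr := by
    rcases (Affine.Point.X_eq_iff (h₁ := hs'') (h₂ := hr'')).mp hx.symm with h1 | h1
    · exact Or.inl (f.injective (Subtype.ext (by rw [hfTs, hfTr]; exact h1)))
    · exact Or.inr (f.injective (by
        rw [map_neg]; exact Subtype.ext (by rw [AddSubgroup.coe_neg, hfTs, hfTr]; exact h1)))
  have hxeq : ι s = ι r := by
    rcases key with h1 | h1
    · have h2 : Affine.Point.some (ι s) ys hs' = Affine.Point.some (ι r) yr hr' := by
        rw [← hTs, ← hTr, h1]
      exact (Affine.Point.some.inj h2).1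
    · have h2 : Affine.Point.some (ι s) ys hs' = -Affine.Point.some (ι r) yr hr' := by
        rw [← hTs, ← hTr, h1, AddSubgroup.coe_neg]
        rfl
      rw [Affine.Point.neg_some] at h2
      exact (Affine.Point.some.inj h2).1
  exact (ι.injective hxeq).symm

omit [CharZero K] [V.IsElliptic] [V'.IsElliptic] in
include hf in
/-- The inverse of an equivariant isomorphism is equivariant. [folklore] -/
theorem equivariant_symm (σ : absoluteGaloisGroup K) (Q : geomTorsion V' (3 : ℤ)) :
    f.symm (σ • Q) = σ • f.symm Q :=
  f.injective (by rw [hf, f.apply_symm_apply, f.apply_symm_apply])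

end Transport

end Summit.BirchSwinnertonDyer.BirchSwinnertonDyer.Theorems.CompanionShape

end
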